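import Summits.BirchSwinnertonDyer.BirchSwinnertonDyer.Theorems.AdditiveKolyvaginRoadLocalSign
import HarnessLib

/-!
# Route `AdditiveKolyvaginRoad`, crux `KolyvaginPrimitiveAdditive` (item stmt-BirchSwinnertonDyer-20132):
# stub A1 `stub_rankLoweringAdditive`, input (Equiv) II — complex conjugation acts on `H¹(K_q, E[p])` by the scalar
# sign `ε_q` of a Bertolini–Darmon admissible prime (W. Zhang 2014 (9.2)), PROVED at a general prime `p`
# (cell `pub/bsd-wall`, lead prover `bsd-wall-akr-p1` g2; `--supports stmt-BirchSwinnertonDyer-20132`, helper;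
# p-generic port of zhang3-p1's `KolyvaginRoadThreeMethod2TameSign.lean` §3 and `…LocalEquivOfTame.lean` §4, with
# Serre's conjugation law kept WITH its factor `q` — `q ≢ 1 (mod p)` at a BD-admissible prime)

WHY THIS FILE. (Equiv) — the fourth of the five inputs of akr-p1 g0's reduction of stub A1
(`selQP_rankLowering_of_localGlobal`, p511644) — asks at a BD-admissible `q` (inert in `K`, `q ∤ pN`, `p ∤ q² − 1`,
`a_q ≡ ε(q+1)`) and the place `v ∣ q` for a sign `s` with `loc_v (c_* z) = sgn s · loc_v z` for EVERY `z ∈ H¹(K, E[p])`.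
At `p = 3` (zhang3-p1) conjugation by a Frobenius acts TRIVIALLY on the values of a cocycle on tame inertia
(`q ≡ 1 (mod 3)`); at a BD-admissible prime it multiplies them by `q ≢ 1`, and the sign argument must follow the two
eigenlines `L_ε ⊕ L_{εq}` of `ρ̄(Frob_q)`:
* §1 `serreTwist_of_admQ` — for `v ∋ q`, `𝔓 = 𝔓_{ι₀,𝔐}`, an arithmetic Frobenius `h ∈ Γ_ℚ` at `ι⁻¹𝔓`, `F ∈ Γ_K` with
  `res F = h²`, the transport `t` of `h` lifting `c`, and every continuous cocycle `φ : Γ_K → E(K̄)[p]`: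
  `φ(i) = q · φ(t⁻¹ i t)` and `φ(F i F⁻¹) = q² · φ(i)` for `i ∈ I_𝔓` (the tree's number-field form of Serre 1972 §1.8
  Prop. 6, `apply_eq_nsmul_of_frob_conj` (zhang3-p1): `φ(j) = q · φ(i)` when `res j = h (res i) h⁻¹`; `φ|_{I_𝔓}` is
  additive as `I_𝔓` fixes `E[p]` at the good `v ∤ p`).
* §2 `localEquiv_of_admQ` — (Equiv) VERBATIM for `[K : ℚ] = 2`, `c ≠ 1`. With `h, F, t, ε` of the sibling
  `exists_lift_frob_of_isAdmissiblePrime` (`t ≡ ε` modulo the toric line `(F − 1)E[p]`, `t = εq` on the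
  `q²`-eigenspace of `F`) and a cocycle `φ` of `z`: `c_* z` has cocycle `g ↦ t φ(t⁻¹ g t)`; the cocycle
  `χ = t φ(t⁻¹ · t) − ε φ − ∂P` vanishes at `F` (`t⁻¹ F t = F`), on `I_𝔓` — by the cocycle identity
  `φ(F i F⁻¹) = F φ(i)` and §1, `φ(i)` lies in the `q²`-eigenspace of `F`, so `t φ(t⁻¹ i t) = q⁻¹ · εq · φ(i) = ε φ(i)`
  — and on an open subgroup, hence on `G_𝔓` (`LocalFrob.cocycle_apply_eq_zero_of_mem_decompositionSubgroup`).
NET: with the siblings `…LocalFrobenius` ((Line), (Trans)), `…Iso` ((Iso)) and this file, FOUR of the five inputs of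
A1 are kernel theorems at every prime `p ≥ 5`; what remains is (Cheb) (W. Zhang Lemma 7.3 ∕ BD05 Thm. 3.2).

HONEST FRAMING: theorems only; no definition, no named fact, no `sorry`; (Cheb) and the other stubs untouched; nothing
is booked.

References: [cite: WZhang2014, §9 (9.2), Notations (xiv)] [cite: SerreInventiones1972, §1.8 Prop. 6]
[cite: BertoliniDarmon2005, §2.2 Lemma 2.6] [cite: GrossLMS1991, §5 (5.1), §9 Prop. 9.6]
[cite: NeukirchANT1999, Ch. I §9 (9.4), Ch. II §9 Prop. (9.6)].
-/

-- single-conjunct summit: `Summit.BirchSwinnertonDyer.BirchSwinnertonDyer.…` repeats the name by design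
set_option linter.dupNamespace false

noncomputable section

open scoped Pointwise
open WeierstrassCurve NumberField IsDedekindDomain Field Rat.HeightOneSpectrum
open Literature.NumberTheory.EllipticCurves Literature.NumberTheory.GaloisRepresentations Module

namespace Summit.BirchSwinnertonDyer.BirchSwinnertonDyer.Theorems.AdditiveKoly

open Summit.BirchSwinnertonDyer.Rank1Residual.X11b.Three.Koly.Method2

universe u

/-! ## §1 Serre's conjugation law at the place above a Bertolini–Darmon admissible prime -/

section Serre

variable (K : Type) [Field K] [NumberField K] (W : WeierstrassCurve ℚ) [W.IsElliptic] [W.IsGloballyMinimal]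
  (p : ℕ) [Fact p.Prime]

/-- **Serre's conjugation law on cocycle values at the place above a BD-admissible prime, for `[K : ℚ] = 2`.** For
`v ∋ q` (`q` BD-admissible), `𝔓 = 𝔓_{ι₀,𝔐}`, an arithmetic Frobenius `h ∈ Γ_ℚ` at `ι⁻¹𝔓`, `F ∈ Γ_K` with `res F = h²`,
the transport `t` of `h` lifting `c`, and every continuous cocycle `φ : Γ_K → E(K̄)[n]` (`n = p`): for all
`i ∈ I_𝔓`, `φ(i) = q · φ(t⁻¹ i t)` and `φ(F i F⁻¹) = q² · φ(i)` (`φ|_{I_𝔓}` is additive as `I_𝔓` fixes `E[p]` — good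
reduction at `v ∤ p`; `res i = h (res (t⁻¹ i t)) h⁻¹`; zhang3-p1's `apply_eq_nsmul_of_frob_conj` with `B = E[p]`,
`#B = p²` prime to `q`; twice for `F`, `t⁻¹ t⁻¹ g t t = F⁻¹ g F`). Port of zhang3-p1's `tameSign_of_uAdmissible`
WITHOUT the step `q • m = m`. [cite: SerreInventiones1972, §1.8 Prop. 6] [cite: NeukirchANT1999, Ch. II §9 Prop. (9.6)] -/
theorem serreTwist_of_admQ (hK2 : Module.finrank ℚ K = 2) (c : K ≃ₐ[ℚ] K) {n : ℕ} (hn : n = p) :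
    ∀ (v : HeightOneSpectrum (𝓞 K)) (𝔐 : Ideal (HeightOneSpectrum.localAbsIntegers v)),
      𝔐 ∈ v.localPrimesAbove → ∀ q : ℕ,
      BertoliniDarmon2005.IsAdmissiblePrime (W.conductorNorm ℤ) K (fun ℓ ↦ W.frobeniusTrace ℓ) p 1 q →
      (q : 𝓞 K) ∈ v.asIdeal →
      ∀ (h : absoluteGaloisGroup ℚ) (F : absoluteGaloisGroup K),
        IsArithFrobAt (𝓞 ℚ) h ((v.primeBelow (closureEmb (K := K) (v.adicCompletion K)) 𝔐).comap
          (absIntegersMap ℚ K)) → absGaloisRestrict ℚ K F = h ^ 2 →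
      ∀ (ht : IsLiftOfAut c (absGaloisTransport (K := ℚ) (L := K) h).toRingEquiv)
        (φ : contOneCocycles (discreteTopRep (absoluteGaloisGroup K) (geomTorsion (W.baseChange K) (n : ℤ)))),
      ∀ i ∈ (v.primeBelow (closureEmb (K := K) (v.adicCompletion K)) 𝔐).inertia (absoluteGaloisGroup K),
        φ.1 i = q • φ.1 (ht.conjGalCMH i) ∧ φ.1 (F * i * F⁻¹) = (q * q) • φ.1 i := by
  intro v 𝔐 h𝔐 q hq hqv h F hh hF ht φ
  have hp : p.Prime := Fact.out
  have hnP : n.Prime := by rw [hn]; exact hp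
  have hn0 : n ≠ 0 := hnP.ne_zero
  haveI : Algebra.IsQuadraticExtension ℚ K := ⟨hK2⟩
  obtain ⟨hgood, hpv⟩ := hasGoodReductionAt_of_isAdmissiblePrime W K hq v hqv
  have hnv : ((n : ℤ) : 𝓞 K) ∉ v.asIdeal := by rw [hn]; exact hpv
  obtain ⟨hqprime, hqpN, hinert, -, -⟩ := hq
  have hqn : q ≠ n := by
    rintro rfl
    rw [hn] at hqpN
    exact hqpN (dvd_mul_right _ _)
  set ι₀ := closureEmb (K := K) (v.adicCompletion K) with hι₀
  set 𝔓 := v.primeBelow ι₀ 𝔐 with h𝔓def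
  have h𝔓 : 𝔓 ∈ v.primesAbove := HeightOneSpectrum.primeBelow_mem_primesAbove h𝔐
  haveI := h𝔓.1
  have hwv : v.asIdeal.under (𝓞 ℚ) = (v.under (𝓞 ℚ)).asIdeal := rfl
  have hqw : (q : 𝓞 ℚ) ∈ (v.under (𝓞 ℚ)).asIdeal := by
    rw [← hwv, Ideal.under_def, Ideal.mem_comap, map_natCast]; exact hqv
  have h𝔓' : 𝔓.comap (absIntegersMap ℚ K) ∈ (v.under (𝓞 ℚ)).primesAbove :=
    comap_absIntegersMap_mem_primesAbove hwv h𝔓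
  haveI := h𝔓'.1
  have hunr : Algebra.IsUnramifiedIn (𝓞 K) (v.under (𝓞 ℚ)).asIdeal :=
    isUnramifiedIn_of_span_natCast_isPrime hqprime hinert hqw
  have hI : 𝔓.inertia (absoluteGaloisGroup K) ≤ torsionFixing (W.baseChange K) (n : ℤ) :=
    inertia_le_torsionFixing (W.baseChange K) (fun h' ↦ h' hgood) hnv ι₀ h𝔐
  -- `F` is in the decomposition group (`f(v|q) = 2` makes it a Frobenius at `𝔓`), `h` in that of `𝔓'`
  have hFD : F ∈ 𝔓.decompositionSubgroup (absoluteGaloisGroup K) :=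
    (isArithFrobAt_of_absGaloisRestrict_eq_pow (F := ℚ) (M := K) hwv h𝔓 hh
      (by rw [hF, LocalFrob.inertiaDeg_eq_two_of_isPrime_span K hK2 hqprime hinert v hqv])).mem_stabilizer
  have hhD : h ∈ (𝔓.comap (absIntegersMap ℚ K)).decompositionSubgroup (absoluteGaloisGroup ℚ) := hh.mem_stabilizer
  -- conjugation by `t` preserves `I_𝔓`; `t⁻¹ (t⁻¹ g t) t = F⁻¹ g F`
  have hconjI : ∀ i ∈ 𝔓.inertia (absoluteGaloisGroup K), ht.conjGalCMH i ∈ 𝔓.inertia (absoluteGaloisGroup K) := by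
    intro i hi
    rw [LocalFrob.mem_inertia_iff_absGaloisRestrict_mem K, LocalFrob.absGaloisRestrict_conjGalCMH K ht]
    have hstab : h⁻¹ • 𝔓.comap (absIntegersMap ℚ K) = 𝔓.comap (absIntegersMap ℚ K) :=
      Ideal.mem_decompositionSubgroup_iff.mp (Subgroup.inv_mem _ hhD)
    have := LocalFrob.conj_mem_inertia_smul ((LocalFrob.mem_inertia_iff_absGaloisRestrict_mem K 𝔓 i).mp hi) h⁻¹
    rwa [inv_inv, hstab] at this
  have hconj2 : ∀ g : absoluteGaloisGroup K, ht.conjGalCMH (ht.conjGalCMH g) = F⁻¹ * g * F := fun g ↦ by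
    apply absGaloisRestrict_injective (K := ℚ) (L := K)
    rw [LocalFrob.absGaloisRestrict_conjGalCMH K ht, LocalFrob.absGaloisRestrict_conjGalCMH K ht, map_mul, map_mul,
      map_inv, hF, pow_two]
    group
  -- Serre's law for `g = φ`, `B = E[p]`
  haveI : Finite (geomTorsion (W.baseChange K) (n : ℤ)) :=
    finite_torsionPoints_holds (W.baseChange K) (AlgebraicClosure K) (by exact_mod_cast hn0)
  have hB : (Nat.card (geomTorsion (W.baseChange K) (n : ℤ))).Coprime q := by
    have hc : Nat.card (geomTorsion (W.baseChange K) (n : ℤ)) = n ^ 2 :=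
      card_torsionPoints_eq_sq_holds (W.baseChange K) (AlgebraicClosure K) (n := n) (by exact_mod_cast hn0)
    rw [hc]
    exact Nat.Coprime.pow_left _ ((Nat.coprime_primes hnP hqprime).mpr (Ne.symm hqn))
  have hadd : ∀ a b : absoluteGaloisGroup K,
      absGaloisRestrict ℚ K a ∈ (𝔓.comap (absIntegersMap ℚ K)).inertia (absoluteGaloisGroup ℚ) →
      φ.1 (a * b) = φ.1 a + φ.1 b := fun a b ha ↦ by
    rw [φ.2, discreteTopRep_ρ_apply, smul_eq_of_mem_torsionFixing (W.baseChange K) _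
      (hI ((LocalFrob.mem_inertia_iff_absGaloisRestrict_mem K 𝔓 a).mpr ha))]
  have hSerre : ∀ i j : absoluteGaloisGroup K, i ∈ 𝔓.inertia (absoluteGaloisGroup K) →
      absGaloisRestrict ℚ K j = h * absGaloisRestrict ℚ K i * h⁻¹ → φ.1 j = q • φ.1 i := by
    intro i j hi hj
    exact LocalFrob.apply_eq_nsmul_of_frob_conj K hqprime hqw hunr h𝔓' hh hB φ.1 φ.1.continuous hadd
      ((LocalFrob.mem_inertia_iff_absGaloisRestrict_mem K 𝔓 i).mp hi) hj
  -- (1) `φ(i) = q · φ(t⁻¹ i t)`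
  have h1 : ∀ i ∈ 𝔓.inertia (absoluteGaloisGroup K), φ.1 i = q • φ.1 (ht.conjGalCMH i) := by
    intro i hi
    refine hSerre (ht.conjGalCMH i) i (hconjI i hi) ?_
    rw [LocalFrob.absGaloisRestrict_conjGalCMH K ht]; group
  intro i hi
  refine ⟨h1 i hi, ?_⟩
  -- (2) `φ(F i F⁻¹) = q² · φ(i)`: (1) twice
  have hi2 : F * i * F⁻¹ ∈ 𝔓.inertia (absoluteGaloisGroup K) := conj_mem_inertia K hFD hi
  have hstep := h1 _ (hconjI _ hi2)
  rw [hconj2] at hstep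
  have hii : F⁻¹ * (F * i * F⁻¹) * F = i := by group
  rw [hii] at hstep
  rw [h1 _ hi2, hstep, smul_smul]

end Serre

/-! ## §2 (Equiv) VERBATIM at a general prime -/

section Equiv

variable (W : WeierstrassCurve ℚ) [W.IsElliptic] [W.IsGloballyMinimal] (K : Type) [Field K] [NumberField K]
  (p : ℕ) [Fact p.Prime]

/-- The lift lemma of the sibling at a general torsion exponent `n = p` (for use with `n := p ^ 1`). [folklore] -/
private theorem exists_lift_frob_of_isAdmissiblePrime' (hK2 : Module.finrank ℚ K = 2) {c : K ≃ₐ[ℚ] K}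
    (hc1 : c ≠ 1) {n : ℕ} (hn : n = p) {q : ℕ}
    (hq : BertoliniDarmon2005.IsAdmissiblePrime (W.conductorNorm ℤ) K (fun ℓ ↦ W.frobeniusTrace ℓ) p 1 q)
    (v : HeightOneSpectrum (𝓞 K)) (hqv : (q : 𝓞 K) ∈ v.asIdeal)
    {𝔐 : Ideal (HeightOneSpectrum.localAbsIntegers v)} (h𝔐 : 𝔐 ∈ v.localPrimesAbove) :
    ∃ (h : absoluteGaloisGroup ℚ) (F : absoluteGaloisGroup K)
      (ht : IsLiftOfAut c (absGaloisTransport (K := ℚ) (L := K) h).toRingEquiv) (ε : ℤ),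
      IsArithFrobAt (𝓞 ℚ) h ((v.primeBelow (closureEmb (K := K) (v.adicCompletion K)) 𝔐).comap (absIntegersMap ℚ K)) ∧
      IsArithFrobAt (𝓞 K) F (v.primeBelow (closureEmb (K := K) (v.adicCompletion K)) 𝔐) ∧
      absGaloisRestrict ℚ K F = h ^ 2 ∧ ht.conjGalCMH F = F ∧ (ε = 1 ∨ ε = -1) ∧
      (∀ y : geomTorsion (W.baseChange K) (n : ℤ), ∃ m : geomTorsion (W.baseChange K) (n : ℤ),
        ht.torsionMap W (n : ℤ) y - ε • y = F • m - m) ∧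
      ∀ y : geomTorsion (W.baseChange K) (n : ℤ), F • y = ((q : ℤ) ^ 2) • y →
        ht.torsionMap W (n : ℤ) y = (ε * q) • y := by
  subst hn
  exact exists_lift_frob_of_isAdmissiblePrime W K hK2 hc1 hq v hqv h𝔐

set_option maxHeartbeats 400000 in
/-- **(Equiv) of `selQP_rankLowering_of_localGlobal` at a general prime `p`, PROVED for `[K : ℚ] = 2` and `c ≠ 1`**
(W. Zhang 2014 (9.2): complex conjugation acts on `H¹(K_q, E[p])` by the scalar sign `ε_q` at every
Bertolini–Darmon admissible `q`). With `h, F, t, ε` of `exists_lift_frob_of_isAdmissiblePrime` at the place `v ∣ q` and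
a cocycle `φ` of `z`: `c_* z` has cocycle `g ↦ t φ(t⁻¹ g t)`; the cocycle `χ = t φ(t⁻¹ · t) − ε φ − ∂P` (`P` from
`t φ(F) − ε φ(F) ∈ (F − 1)E[p]`) vanishes at `F` (`t⁻¹ F t = F`), on `I_𝔓` (§1: `φ(t⁻¹ i t) = q⁻¹ φ(i)` and `φ(i)` lies
in the `q²`-eigenspace of `F`, where `t = εq`) and on an open subgroup, so on `G_𝔓`; hence `loc_v(c_* z − ε z) = 0`.
[cite: WZhang2014, §9 (9.2)] [cite: SerreInventiones1972, §1.8 Prop. 6] [cite: GrossLMS1991, §5 (5.1), §9 Prop. 9.6] -/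
theorem localEquiv_of_admQ (hK2 : Module.finrank ℚ K = 2) {c : K ≃ₐ[ℚ] K} (hc1 : c ≠ 1) :
    ∀ q : AdmQ W K p, ∃ s : Bool, ∀ v : HeightOneSpectrum (𝓞 K), ((q : ℕ) : 𝓞 K) ∈ v.asIdeal → ∀ z : Vp W K p,
      (W.baseChange K).torsionLocMap (v.adicCompletion K) ((p ^ 1 : ℕ) : ℤ) (conjAct W c ((p ^ 1 : ℕ) : ℤ) z) =
        sgnP s • (W.baseChange K).torsionLocMap (v.adicCompletion K) ((p ^ 1 : ℕ) : ℤ) z := by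
  intro q
  have hp : p.Prime := Fact.out
  -- the unique place above `q`, a prime of `\bar 𝓞_v` and the lift there
  have hq0 : (q : ℕ) ≠ 0 := q.2.1.ne_zero
  have hqP : (Ideal.span {((q : ℕ) : 𝓞 K)}).IsPrime := q.2.2.2.1
  have hqbot : Ideal.span {((q : ℕ) : 𝓞 K)} ≠ ⊥ := by
    rw [Ne, Ideal.span_singleton_eq_bot]; exact_mod_cast hq0
  set v₀ : HeightOneSpectrum (𝓞 K) := ⟨Ideal.span {((q : ℕ) : 𝓞 K)}, hqP, hqbot⟩ with hv₀
  have hqv₀ : ((q : ℕ) : 𝓞 K) ∈ v₀.asIdeal := Ideal.subset_span rfl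
  obtain ⟨𝔐, h𝔐⟩ := v₀.localPrimesAbove_nonempty
  obtain ⟨hgood, hpv⟩ := hasGoodReductionAt_of_isAdmissiblePrime W K q.2 v₀ hqv₀
  obtain ⟨h, F, ht, ε, hFrob, hFrobF, hF, hcF, hε, hquot, hker⟩ :=
    exists_lift_frob_of_isAdmissiblePrime' W K p hK2 hc1 (n := p ^ 1) (pow_one p) q.2 v₀ hqv₀ h𝔐
  have hST := serreTwist_of_admQ K W p hK2 c (n := p ^ 1) (pow_one p) v₀ 𝔐 h𝔐 q q.2 hqv₀ h F hFrob hF ht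
  obtain ⟨s, hs⟩ : ∃ s : Bool, sgnP s = ε := by
    rcases hε with rfl | rfl
    · exact ⟨true, rfl⟩
    · exact ⟨false, rfl⟩
  refine ⟨s, fun v hqv z ↦ ?_⟩
  have hvv : v = v₀ := placesAbove_eq_of_isPrime_span K hqP hq0 hqv₀ hqv
  subst hvv
  set ι₀ := closureEmb (K := K) (v₀.adicCompletion K) with hι₀
  set n : ℤ := ((p ^ 1 : ℕ) : ℤ) with hn
  have hpn : n ≠ 0 := by rw [hn]; exact_mod_cast pow_ne_zero 1 hp.ne_zero
  have hpv' : ((((p ^ 1 : ℕ) : ℤ)) : 𝓞 K) ∉ v₀.asIdeal := by rw [Nat.pow_one]; exact hpv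
  have h𝔓 := HeightOneSpectrum.primeBelow_mem_primesAbove (ι := ι₀) h𝔐
  haveI := h𝔓.1
  have hI : (v₀.primeBelow ι₀ 𝔐).inertia (absoluteGaloisGroup K) ≤ torsionFixing (W.baseChange K) n :=
    inertia_le_torsionFixing (W.baseChange K) (fun h' ↦ h' hgood) hpv' ι₀ h𝔐
  have hFD : F ∈ (v₀.primeBelow ι₀ 𝔐).decompositionSubgroup (absoluteGaloisGroup K) := hFrobF.mem_stabilizer
  obtain ⟨φ, rfl⟩ :=
    oneCocycleClass_surjective (discreteTopRep (absoluteGaloisGroup K) (geomTorsion (W.baseChange K) n)) z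
  -- the cocycle of `c_* z`
  set ψ := contOneCocycles.pullback ht.conjGalCMH
    (resHomOfEquivariant ht.conjGalCMH (ht.torsionMap W n) (ht.torsionMap_smul W n)) φ with hψ
  have hconj : conjAct W c n (oneCocycleClass _ φ) = oneCocycleClass _ ψ := by
    rw [← ht.conjH1_eq_conjAct W n]
    unfold IsLiftOfAut.conjH1
    simp only [LinearMap.toAddMonoidHom_coe, ContinuousLinearMap.coe_coe]
    exact map_oneCocycleClass _ _ _ φ
  have hψapply : ∀ g, ψ.1 g = ht.torsionMap W n (φ.1 (ht.conjGalCMH g)) := fun g ↦ rfl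
  -- `χ = ψ − ε φ`; its class is `c_* z − sgn s • z`; it is locally a coboundary
  have hclass : oneCocycleClass _ (ψ - ε • φ) = oneCocycleClass _ ψ - ε • oneCocycleClass _ φ := by
    rw [oneCocycleClass_sub]
    congr 1
    exact map_zsmul (oneCocycleClassₗ (discreteTopRep (absoluteGaloisGroup K) (geomTorsion (W.baseChange K) n))) ε φ
  suffices hmem : oneCocycleClass _ (ψ - ε • φ) ∈ (W.baseChange K).torsionLocalKer (v₀.adicCompletion K) n by
    have h0 : (W.baseChange K).torsionLocMap (v₀.adicCompletion K) n (oneCocycleClass _ (ψ - ε • φ)) = 0 := hmem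
    rw [hclass, map_sub, map_zsmul, sub_eq_zero, ← hconj] at h0
    rw [h0, hs]
  -- values of `φ` on inertia lie in the `q²`-eigenspace of `F`
  have hφI : ∀ i ∈ (v₀.primeBelow ι₀ 𝔐).inertia (absoluteGaloisGroup K),
      F • φ.1 i = (((q : ℕ) : ℤ) ^ 2) • φ.1 i := by
    intro i hi
    have hSTi := (hST φ i hi).2
    have hconjI := conj_mem_inertia K hFD hi
    -- cocycle identity: `φ(F i F⁻¹) = φ(F) + F φ(i) + F i φ(F⁻¹)`, `φ(F⁻¹) = −F⁻¹ φ(F)`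
    have h1 := φ.2 (F * i) F⁻¹
    have h2 := φ.2 F i
    have h3 := φ.2 F F⁻¹
    rw [mul_inv_cancel, contOneCocycles.apply_one, discreteTopRep_ρ_apply] at h3
    rw [discreteTopRep_ρ_apply] at h1 h2
    rw [hSTi, h2] at h1
    -- `(F i) • φ(F⁻¹) = F • φ(F⁻¹)` since `F i F⁻¹` fixes `E[p]`
    have h4 : (F * i) • φ.1 F⁻¹ = F • φ.1 F⁻¹ := by
      have := smul_eq_of_mem_torsionFixing (W.baseChange K) n (hI hconjI) (F • φ.1 F⁻¹)
      rw [← mul_smul, mul_assoc, inv_mul_cancel, mul_one] at this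
      exact this
    rw [h4] at h1
    have h5 : F • φ.1 F⁻¹ = -φ.1 F := eq_neg_of_add_eq_zero_right h3.symm
    rw [h5] at h1
    -- `q² φ i = φ F + F φ i - φ F`
    have h6 : φ.1 F + F • φ.1 i + -φ.1 F = F • φ.1 i := by abel
    rw [h6] at h1
    rw [← h1, ← natCast_zsmul]
    congr 1
    push_cast
    ring
  -- the coboundary correction at `F`
  obtain ⟨P, hP⟩ := hquot (φ.1 F)
  obtain ⟨χ, hχclass, hχapply⟩ := LocalFrob.exists_cocycle_sub_coboundary (W.baseChange K) (ψ - ε • φ) P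
  rw [← hχclass, LocalFrob.oneCocycleClass_mem_torsionLocalKer_iff (W.baseChange K) (n := p ^ 1)
    (pow_ne_zero 1 hp.ne_zero) h𝔐 χ]
  refine ⟨0, fun d hd ↦ ?_⟩
  rw [smul_zero, sub_zero]
  obtain ⟨U, hU, hχU⟩ := LocalFrob.exists_isOpen_subgroup_apply_eq_zero (W.baseChange K) (n := n) hpn χ
  refine LocalFrob.cocycle_apply_eq_zero_of_mem_decompositionSubgroup (W.baseChange K) h𝔓 hFrobF χ ?_ (fun i hi ↦ ?_)
    hU hχU hd
  · -- at `F`: `t φ(t⁻¹ F t) − ε φ(F) − (F P − P) = 0`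
    rw [hχapply]
    change ψ.1 F - ε • φ.1 F - (F • P - P) = 0
    rw [hψapply, hcF, ← hP, sub_self]
  · -- on inertia: `t φ(t⁻¹ i t) − ε φ(i) − (i P − P) = εq · φ(t⁻¹ i t) − ε · q · φ(t⁻¹ i t) = 0`
    rw [hχapply, smul_eq_of_mem_torsionFixing (W.baseChange K) n (hI hi), sub_self, sub_zero]
    change ψ.1 i - ε • φ.1 i = 0
    have hci : ht.conjGalCMH i ∈ (v₀.primeBelow ι₀ 𝔐).inertia (absoluteGaloisGroup K) := by
      -- `t⁻¹ i t ∈ I_𝔓`: from §1 applied to ... (conjugation by `t` preserves `I_𝔓`)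
      have hwv : v₀.asIdeal.under (𝓞 ℚ) = (v₀.under (𝓞 ℚ)).asIdeal := rfl
      have hhD : h ∈ ((v₀.primeBelow ι₀ 𝔐).comap (absIntegersMap ℚ K)).decompositionSubgroup (absoluteGaloisGroup ℚ) :=
        hFrob.mem_stabilizer
      rw [LocalFrob.mem_inertia_iff_absGaloisRestrict_mem K, LocalFrob.absGaloisRestrict_conjGalCMH K ht]
      have hstab : h⁻¹ • (v₀.primeBelow ι₀ 𝔐).comap (absIntegersMap ℚ K) =
          (v₀.primeBelow ι₀ 𝔐).comap (absIntegersMap ℚ K) :=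
        Ideal.mem_decompositionSubgroup_iff.mp (Subgroup.inv_mem _ hhD)
      have := LocalFrob.conj_mem_inertia_smul
        ((LocalFrob.mem_inertia_iff_absGaloisRestrict_mem K (v₀.primeBelow ι₀ 𝔐) i).mp hi) h⁻¹
      rwa [inv_inv, hstab] at this
    rw [hψapply, (hST φ i hi).1, hker _ (hφI _ hci), ← natCast_zsmul, smul_smul, sub_self]

end Equiv

end Summit.BirchSwinnertonDyer.BirchSwinnertonDyer.Theorems.AdditiveKoly

end
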